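import Summits.Ventures.HSemireg.WedgeHankelSubstitutionSwapEigenspaces
import Summits.Ventures.HSemireg.WedgeHankelSubstitutionQuarterTurn
import Summits.Ventures.HSemireg.WedgeHankelClassSpaceIrreducibleCharP

/-!
# Venture HSemireg — THE QUARTER TURN ON TH-7's SPIKES: `SbC(0 −1 1 0) E_p = (−1)^{n−p} E_{n−p}`; for `n` EVEN and `2 ≠ 0` (no `√−1` needed) the class space splits as
# `ker(Q − 1) ⊕ ker(Q + 1)` with `dim ker(Q − 1) = 2⌊n/4⌋ + 1` (the SIGNED PALINDROMES `E_p + (−1)^p E_{n−p}`) and `dim ker(Q + 1) = 2⌊(n+2)/4⌋` (the signed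
# anti-palindromes) — `n/2 + 1` and `n/2` in the order decided by the sign `(−1)^{n/2}` of the middle spike

HONEST FRAMING. Part of the Lean index of the computation cell `pub-hsemireg` (seat p10 gen 22, Sunday typer «UNIFORM-IN-n»).
Finite-dimensional EXTERIOR ALGEBRA + linear algebra ONLY: no variety, no cohomology theory, no sheaf, no Ext group, no semiregularity map;
nothing here says that HC / HC_CM / HC_AV holds; no Literature fact is declared or used.  Custodian versions as in `WedgeHankelSiegelIdeal` (1/3) and `WedgeHankelFrameChange`;
the dictionary (the quarter turn `x ↦ y, y ↦ −x` of the letters' plane acting on `Sym^n`; for `n` even its `±1`-eigenspaces are the rotation-(anti)invariant binary forms) is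
QUOTED, never asserted.

WHAT IS IN THE TREE.  K10 (`WedgeHankelSubstitutionQuarterTurn`): `SbC_quarter_mul_self` (`Q² = (−1)^n`), `SbC_quarter_spike_top` (`Q E_n = E_0`), `minpoly_SbC_quarter` (`X² − (−1)^n`),
`hasEigenvalue_SbC_quarter_iff_of_even` (eigenvalues `±1` for `n` even) — its header lists the eigenspace DIMENSIONS as not typed; K14 (`WedgeHankelSubstitutionSwapEigenspaces`):
`SbC_swap_spikeBasis` (`E_p ↦ E_{n−p}`), the palindromes and `dim ker(S ∓ 1) = n/2 + 1, (n+1)/2`; K3 `SbC_diag_spikeBasis`; K1 `linearIndependent_of_repr_pivot`; K18 (sibling leaf, not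
imported) does the quarter turn over a field WITH `√−1` via an eigenbasis.  THIS FILE (namespace `Summit.Ventures.HSemireg.Wedge.HankelFrameChange` continued; imports K14, K10, K3)
types the quarter turn's eigenspaces for `n` even over ANY field with `2 ≠ 0`:
* §307 **`SbC_quarter_eq_diag_mul_swap`** (`Q = SbC(1 0 0 −1)·SbC(0 1 1 0)`: swap, then `y ↦ −y`), **`SbC_quarter_spikeBasis`: `Q E_p = (−1)^{n−p} • E_{n−p}`**, `SbC_quarter_eq_sum`,
  **`repr_SbC_quarter`** (`repr (Q v) a = (−1)^a · repr v (n−a)`), `mem_eigenspace_SbC_quarter_iff`; for `n` even: `SbC_quarter_spikeBasis_of_even`, `SbC_quarter_mul_self_of_even` (`Q² = 1`),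
  **`mem_ker_SbC_quarter_sub_one_iff`** (`Qv = v ⇔ repr v (n−a) = (−1)^a repr v a`: the SIGNED PALINDROMES, every `n`), `mem_ker_SbC_quarter_add_one_iff`.
* §308 GENERALITY (`2 ≠ 0`): `ker_sub_one_inf_ker_add_one_eq_bot` (any `T`), `ker_sub_one_sup_ker_add_one_eq_top_of_mul_self` (`T·T = 1`), `finrank_ker_sub_one_add_of_mul_self`
  (`dim ker(T − 1) + dim ker(T + 1) = dim V`).
* §309 `n` EVEN, `2 ≠ 0`: `spike_add_sign_rev_mem_ker` (`E_a + (−1)^a E_{n−a} ∈ ker(Q − 1)`), `spike_sub_sign_rev_mem_ker` (`E_a − (−1)^a E_{n−a} ∈ ker(Q + 1)`), their independence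
  (`linearIndependent_spike_add_sign_rev` on `2a < n ∨ (2a = n, a even)`, `linearIndependent_spike_sub_sign_rev` on `2a < n ∨ (2a = n, a odd)`), the lower bounds, and
  **`finrank_ker_SbC_quarter_sub_one`: `dim ker(Q − 1) = 2⌊n/4⌋ + 1`**, **`finrank_ker_SbC_quarter_add_one`: `dim ker(Q + 1) = 2⌊(n+2)/4⌋`** (`n ≡ 0 (4)`: `n/2 + 1` and `n/2`;
  `n ≡ 2 (4)`: `n/2` and `n/2 + 1` — the middle spike `E_{n/2}` has `Q E_{n/2} = (−1)^{n/2} E_{n/2}`), `ker_SbC_quarter_sub_one_sup_add_one_eq_top`.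
NOT typed here: `n` odd (then `Q² = −1`: K10 `not_hasEigenvalue_SbC_quarter_of_odd` without `√−1`, K18 with it); characteristic `2` (`Q` = swap, unipotent, K15); anything Ext-side.
New names only.
-/

open Module

namespace Summit.Ventures.HSemireg.Wedge.HankelFrameChange

open Summit.Ventures.HSemireg.Wedge Summit.Ventures.HSemireg.Wedge.Kunneth Summit.Ventures.HSemireg.Wedge.Hankel
  Summit.Ventures.HSemireg.Wedge.BasisFree Summit.Ventures.HSemireg.Wedge.HankelSiegel Summit.Ventures.HSemireg.Wedge.HankelSiegelIdeal
  Summit.Ventures.HSemireg.Wedge.KunnethKernel Summit.Ventures.HSemireg.Wedge.HankelRankOne Summit.Ventures.HSemireg.Wedge.KernelDuality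

variable (K : Type*) [Field K] {n : ℕ}

/-! ## §307. The quarter turn on th-7's spikes -/

/-- **`SbC(0 −1 1 0) = SbC(1 0 0 −1)·SbC(0 1 1 0)`**: on the classes the quarter turn is the swap followed by `y ↦ −y` (J5 `SbC_mul`). -/
theorem SbC_quarter_eq_diag_mul_swap : SbC K 0 (-1) 1 0 (n := n) = SbC K 1 0 0 (-1) * SbC K 0 1 1 0 := by
  rw [SbC_mul]
  congr 1 <;> ring

/-- **`SbC(0 −1 1 0) E_p = (−1)^{n−p} • E_{n−p}`**: the quarter turn permutes th-7's spikes by reversal, with signs. -/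
theorem SbC_quarter_spikeBasis (p : Fin (n + 1)) : SbC K 0 (-1) 1 0 (spikeBasis K n p) = (-1 : K) ^ (n - (p : ℕ)) • spikeBasis K n (Fin.rev p) := by
  have hr : ((Fin.rev p : Fin (n + 1)) : ℕ) = n - (p : ℕ) := by rw [Fin.val_rev]; omega
  rw [SbC_quarter_eq_diag_mul_swap, Module.End.mul_apply, SbC_swap_spikeBasis, SbC_diag_spikeBasis, one_pow, one_mul, hr]

/-- `SbC(0 −1 1 0) v = Σ_p ((−1)^{n−p} · repr v p) • E_{n−p}`. -/
theorem SbC_quarter_eq_sum (v : spikeSpan K n) :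
    SbC K 0 (-1) 1 0 v = ∑ p : Fin (n + 1), ((-1 : K) ^ (n - (p : ℕ)) * (spikeBasis K n).repr v p) • spikeBasis K n (Fin.rev p) := by
  conv_lhs => rw [← (spikeBasis K n).sum_repr v]
  rw [map_sum]
  exact Finset.sum_congr rfl fun p _ => by rw [map_smul, SbC_quarter_spikeBasis, smul_smul, mul_comm]

/-- **`repr (SbC(0 −1 1 0) v) a = (−1)^a · repr v (n−a)`**: the quarter turn reverses coordinates with the sign `(−1)^a`. -/
theorem repr_SbC_quarter (v : spikeSpan K n) (a : Fin (n + 1)) :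
    (spikeBasis K n).repr (SbC K 0 (-1) 1 0 v) a = (-1 : K) ^ (a : ℕ) * (spikeBasis K n).repr v (Fin.rev a) := by
  have hr : ∀ b : Fin (n + 1), n - ((Fin.rev b : Fin (n + 1)) : ℕ) = (b : ℕ) := fun b => by rw [Fin.val_rev]; omega
  rw [SbC_quarter_eq_sum, ← Equiv.sum_comp Fin.revPerm (fun p => ((-1 : K) ^ (n - (p : ℕ)) * (spikeBasis K n).repr v p) • spikeBasis K n (Fin.rev p))]
  simp only [Fin.revPerm_apply, Fin.rev_rev, hr]
  rw [show (∑ p : Fin (n + 1), ((-1 : K) ^ (p : ℕ) * (spikeBasis K n).repr v (Fin.rev p)) • spikeBasis K n p) =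
      ∑ p : Fin (n + 1), (fun p : Fin (n + 1) => (-1 : K) ^ (p : ℕ) * (spikeBasis K n).repr v (Fin.rev p)) p • spikeBasis K n p from rfl, Basis.repr_sum_self]

/-- `v ∈ eigenspace(SbC(0 −1 1 0), m) ⇔ (−1)^a · repr v (n−a) = m · repr v a` for all `a`. -/
theorem mem_eigenspace_SbC_quarter_iff (v : spikeSpan K n) (m : K) :
    v ∈ Module.End.eigenspace (SbC K 0 (-1) 1 0 (n := n)) m ↔ ∀ a : Fin (n + 1), (-1 : K) ^ (a : ℕ) * (spikeBasis K n).repr v (Fin.rev a) = m * (spikeBasis K n).repr v a := by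
  rw [Module.End.mem_eigenspace_iff, ← (spikeBasis K n).repr.injective.eq_iff, Finsupp.ext_iff]
  exact forall_congr' fun a => by rw [repr_SbC_quarter, map_smul, Finsupp.smul_apply, smul_eq_mul]

/-- `n` even: **`SbC(0 −1 1 0) E_p = (−1)^p • E_{n−p}`** (`(−1)^{n−p} = (−1)^p`). -/
theorem SbC_quarter_spikeBasis_of_even (he : Even n) (p : Fin (n + 1)) : SbC K 0 (-1) 1 0 (spikeBasis K n p) = (-1 : K) ^ (p : ℕ) • spikeBasis K n (Fin.rev p) := by
  -- `(−1)^{n−p} = (−1)^{n−p}·((−1)^p)² = (−1)^n·(−1)^p = (−1)^p`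
  have h1 : (-1 : K) ^ (n - (p : ℕ)) * (-1) ^ (p : ℕ) = 1 := by rw [← pow_add, Nat.sub_add_cancel (Nat.le_of_lt_succ p.2), he.neg_one_pow]
  have h2 : (-1 : K) ^ (p : ℕ) * (-1) ^ (p : ℕ) = 1 := by rw [← pow_add, ← two_mul, pow_mul, neg_one_sq, one_pow]
  have h : (-1 : K) ^ (n - (p : ℕ)) = (-1) ^ (p : ℕ) :=
    calc (-1 : K) ^ (n - (p : ℕ)) = (-1) ^ (n - (p : ℕ)) * ((-1) ^ (p : ℕ) * (-1) ^ (p : ℕ)) := by rw [h2, mul_one]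
      _ = (-1) ^ (p : ℕ) := by rw [← mul_assoc, h1, one_mul]
  rw [SbC_quarter_spikeBasis, h]

/-- `n` even: **`Q·Q = 1`** on th-7's classes (K10: `Q² = (−1)^n`). -/
theorem SbC_quarter_mul_self_of_even (he : Even n) : SbC K 0 (-1) 1 0 (n := n) * SbC K 0 (-1) 1 0 = 1 := by
  rw [SbC_quarter_mul_self, he.neg_one_pow, one_smul]

/-- **THE FIXED CLASSES OF THE QUARTER TURN ARE THE SIGNED PALINDROMES — `Qv = v ⇔ repr v (n−a) = (−1)^a · repr v a` for all `a`** (every `n`; for `n` odd and `2 ≠ 0` this forces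
`v = 0`, K10). -/
theorem mem_ker_SbC_quarter_sub_one_iff (v : spikeSpan K n) :
    v ∈ LinearMap.ker (SbC K 0 (-1) 1 0 (n := n) - 1) ↔ ∀ a : Fin (n + 1), (spikeBasis K n).repr v (Fin.rev a) = (-1 : K) ^ (a : ℕ) * (spikeBasis K n).repr v a := by
  have h2 : ∀ a : ℕ, (-1 : K) ^ a * (-1) ^ a = 1 := fun a => by rw [← pow_add, ← two_mul, pow_mul, neg_one_sq, one_pow]
  rw [LinearMap.mem_ker, LinearMap.sub_apply, Module.End.one_apply, sub_eq_zero,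
    show SbC K 0 (-1) 1 0 v = v ↔ v ∈ Module.End.eigenspace (SbC K 0 (-1) 1 0 (n := n)) 1 by rw [Module.End.mem_eigenspace_iff, one_smul], mem_eigenspace_SbC_quarter_iff]
  refine forall_congr' fun a => ?_
  rw [one_mul]
  constructor
  · intro h
    calc (spikeBasis K n).repr v (Fin.rev a) = (-1 : K) ^ (a : ℕ) * ((-1 : K) ^ (a : ℕ) * (spikeBasis K n).repr v (Fin.rev a)) := by rw [← mul_assoc, h2, one_mul]
      _ = (-1 : K) ^ (a : ℕ) * (spikeBasis K n).repr v a := by rw [h]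
  · intro h; rw [h, ← mul_assoc, h2, one_mul]

/-- the anti-fixed classes are the signed anti-palindromes — `Qv = −v ⇔ repr v (n−a) = −(−1)^a · repr v a` for all `a` (every `n`). -/
theorem mem_ker_SbC_quarter_add_one_iff (v : spikeSpan K n) :
    v ∈ LinearMap.ker (SbC K 0 (-1) 1 0 (n := n) + 1) ↔ ∀ a : Fin (n + 1), (spikeBasis K n).repr v (Fin.rev a) = -((-1 : K) ^ (a : ℕ) * (spikeBasis K n).repr v a) := by
  have h2 : ∀ a : ℕ, (-1 : K) ^ a * (-1) ^ a = 1 := fun a => by rw [← pow_add, ← two_mul, pow_mul, neg_one_sq, one_pow]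
  rw [LinearMap.mem_ker, LinearMap.add_apply, Module.End.one_apply, add_eq_zero_iff_eq_neg,
    show SbC K 0 (-1) 1 0 v = -v ↔ v ∈ Module.End.eigenspace (SbC K 0 (-1) 1 0 (n := n)) (-1) by rw [Module.End.mem_eigenspace_iff, neg_one_smul], mem_eigenspace_SbC_quarter_iff]
  refine forall_congr' fun a => ?_
  constructor
  · intro h
    calc (spikeBasis K n).repr v (Fin.rev a) = (-1 : K) ^ (a : ℕ) * ((-1 : K) ^ (a : ℕ) * (spikeBasis K n).repr v (Fin.rev a)) := by rw [← mul_assoc, h2, one_mul]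
      _ = -((-1 : K) ^ (a : ℕ) * (spikeBasis K n).repr v a) := by rw [h, neg_one_mul, mul_neg]
  · intro h; rw [h, mul_neg, ← mul_assoc, h2, one_mul, neg_one_mul]

/-! ## §308. Generality: an involution on a space with `2 ≠ 0` -/

section Involution

variable {V : Type*} [AddCommGroup V] [Module K V]

/-- `2 ≠ 0`: `ker(T − 1) ⊓ ker(T + 1) = ⊥` for ANY endomorphism `T` (`Tv = v = −v ⇒ 2v = 0`). -/
theorem ker_sub_one_inf_ker_add_one_eq_bot (h2 : (2 : K) ≠ 0) (T : V →ₗ[K] V) : LinearMap.ker (T - 1) ⊓ LinearMap.ker (T + 1) = ⊥ := by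
  rw [eq_bot_iff]
  intro v hv
  obtain ⟨h₁, h₂⟩ := Submodule.mem_inf.mp hv
  rw [LinearMap.mem_ker, LinearMap.sub_apply, Module.End.one_apply, sub_eq_zero] at h₁
  rw [LinearMap.mem_ker, LinearMap.add_apply, Module.End.one_apply, h₁, ← two_smul K v, smul_eq_zero] at h₂
  exact (Submodule.mem_bot K).mpr (h₂.resolve_left h2)

/-- `2 ≠ 0`, `T·T = 1`: every vector splits as `v = ½(v + Tv) + ½(v − Tv)`, so `ker(T − 1) ⊔ ker(T + 1) = ⊤`. -/
theorem ker_sub_one_sup_ker_add_one_eq_top_of_mul_self (h2 : (2 : K) ≠ 0) {T : V →ₗ[K] V} (hT : T * T = 1) : LinearMap.ker (T - 1) ⊔ LinearMap.ker (T + 1) = ⊤ := by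
  rw [eq_top_iff]
  intro v _
  have hTT : ∀ u : V, T (T u) = u := fun u => by rw [← Module.End.mul_apply, hT, Module.End.one_apply]
  have e : v = (2 : K)⁻¹ • (v + T v) + (2 : K)⁻¹ • (v - T v) := by
    rw [← smul_add, add_add_sub_cancel, ← two_smul K v, smul_smul, inv_mul_cancel₀ h2, one_smul]
  rw [e]
  refine Submodule.add_mem _ (Submodule.mem_sup_left (Submodule.smul_mem _ _ ?_)) (Submodule.mem_sup_right (Submodule.smul_mem _ _ ?_))
  · rw [LinearMap.mem_ker, LinearMap.sub_apply, Module.End.one_apply, map_add, hTT, add_comm, sub_self]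
  · rw [LinearMap.mem_ker, LinearMap.add_apply, Module.End.one_apply, map_sub, hTT, sub_add_sub_cancel', sub_self]

/-- hence **`dim ker(T − 1) + dim ker(T + 1) = dim V`** for an involution `T` on a finite-dimensional space with `2 ≠ 0`. -/
theorem finrank_ker_sub_one_add_of_mul_self [FiniteDimensional K V] (h2 : (2 : K) ≠ 0) {T : V →ₗ[K] V} (hT : T * T = 1) :
    finrank K ↥(LinearMap.ker (T - 1)) + finrank K ↥(LinearMap.ker (T + 1)) = finrank K V := by
  have h := Submodule.finrank_sup_add_finrank_inf_eq (LinearMap.ker (T - 1)) (LinearMap.ker (T + 1))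
  rw [ker_sub_one_inf_ker_add_one_eq_bot K h2 T, finrank_bot, add_zero, ker_sub_one_sup_ker_add_one_eq_top_of_mul_self K h2 hT, finrank_top] at h
  exact h.symm

end Involution

/-! ## §309. `n` even, `2 ≠ 0`: the signed (anti-)palindromes and the two dimensions -/

/-- `n` even: **the signed palindrome `E_a + (−1)^a E_{n−a}` is fixed by the quarter turn.** -/
theorem spike_add_sign_rev_mem_ker (he : Even n) (a : Fin (n + 1)) :
    spikeBasis K n a + (-1 : K) ^ (a : ℕ) • spikeBasis K n (Fin.rev a) ∈ LinearMap.ker (SbC K 0 (-1) 1 0 (n := n) - 1) := by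
  have h2 : (-1 : K) ^ (a : ℕ) * (-1) ^ ((Fin.rev a : Fin (n + 1)) : ℕ) = 1 := by
    rw [← pow_add, Fin.val_rev, show (a : ℕ) + (n + 1 - ((a : ℕ) + 1)) = n by omega, he.neg_one_pow]
  rw [LinearMap.mem_ker, LinearMap.sub_apply, Module.End.one_apply, map_add, map_smul, SbC_quarter_spikeBasis_of_even K he, SbC_quarter_spikeBasis_of_even K he, Fin.rev_rev,
    smul_smul, h2, one_smul, add_comm, sub_self]

/-- `n` even: **the signed anti-palindrome `E_a − (−1)^a E_{n−a}` is negated by the quarter turn.** -/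
theorem spike_sub_sign_rev_mem_ker (he : Even n) (a : Fin (n + 1)) :
    spikeBasis K n a - (-1 : K) ^ (a : ℕ) • spikeBasis K n (Fin.rev a) ∈ LinearMap.ker (SbC K 0 (-1) 1 0 (n := n) + 1) := by
  have h2 : (-1 : K) ^ (a : ℕ) * (-1) ^ ((Fin.rev a : Fin (n + 1)) : ℕ) = 1 := by
    rw [← pow_add, Fin.val_rev, show (a : ℕ) + (n + 1 - ((a : ℕ) + 1)) = n by omega, he.neg_one_pow]
  rw [LinearMap.mem_ker, LinearMap.add_apply, Module.End.one_apply, map_sub, map_smul, SbC_quarter_spikeBasis_of_even K he, SbC_quarter_spikeBasis_of_even K he, Fin.rev_rev,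
    smul_smul, h2, one_smul, sub_add_sub_cancel', sub_self]

/-- **the signed palindromes `E_a + (−1)^a E_{n−a}` for `2a < n`, together with the middle spike when `a = n/2` is even, are linearly independent** (`2 ≠ 0`; pivot `1` or `2` at `a`). -/
theorem linearIndependent_spike_add_sign_rev (h2 : (2 : K) ≠ 0) :
    LinearIndependent K fun a : {a : Fin (n + 1) // 2 * (a : ℕ) < n ∨ (2 * (a : ℕ) = n ∧ (a : ℕ) % 2 = 0)} =>
      spikeBasis K n a + (-1 : K) ^ ((a : Fin (n + 1)) : ℕ) • spikeBasis K n (Fin.rev (a : Fin (n + 1))) := by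
  classical
  refine linearIndependent_of_repr_pivot K (I := fun a : Fin (n + 1) => 2 * (a : ℕ) < n ∨ (2 * (a : ℕ) = n ∧ (a : ℕ) % 2 = 0)) _ 0 (fun a b hb => ?_) fun a => ?_
  · rw [map_add, map_smul, Finsupp.add_apply, Finsupp.smul_apply, Basis.repr_self, Basis.repr_self, Finsupp.single_apply, Finsupp.single_apply, if_neg, if_neg, smul_zero, add_zero]
    · intro e; rw [← e, Fin.val_rev] at hb; have := a.2; omega
    · intro e; rw [← e] at hb; omega
  · refine ⟨(a : Fin (n + 1)), by omega, ?_⟩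
    rw [map_add, map_smul, Finsupp.add_apply, Finsupp.smul_apply, Basis.repr_self, Basis.repr_self, Finsupp.single_eq_same, Finsupp.single_apply, smul_eq_mul]
    by_cases e : Fin.rev (a : Fin (n + 1)) = (a : Fin (n + 1))
    · have hev : Even (((a : Fin (n + 1))) : ℕ) := by
        have h := congrArg Fin.val e; rw [Fin.val_rev] at h; have := a.2; exact Nat.even_iff.mpr (by omega)
      rw [if_pos e, hev.neg_one_pow, mul_one, ← two_mul, mul_one]; exact h2
    · rw [if_neg e, mul_zero, add_zero]; exact one_ne_zero

/-- **the signed anti-palindromes `E_a − (−1)^a E_{n−a}` for `2a < n`, together with the middle spike when `a = n/2` is odd, are linearly independent** (`2 ≠ 0`). -/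
theorem linearIndependent_spike_sub_sign_rev (h2 : (2 : K) ≠ 0) :
    LinearIndependent K fun a : {a : Fin (n + 1) // 2 * (a : ℕ) < n ∨ (2 * (a : ℕ) = n ∧ (a : ℕ) % 2 = 1)} =>
      spikeBasis K n a - (-1 : K) ^ ((a : Fin (n + 1)) : ℕ) • spikeBasis K n (Fin.rev (a : Fin (n + 1))) := by
  classical
  refine linearIndependent_of_repr_pivot K (I := fun a : Fin (n + 1) => 2 * (a : ℕ) < n ∨ (2 * (a : ℕ) = n ∧ (a : ℕ) % 2 = 1)) _ 0 (fun a b hb => ?_) fun a => ?_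
  · rw [map_sub, map_smul, Finsupp.sub_apply, Finsupp.smul_apply, Basis.repr_self, Basis.repr_self, Finsupp.single_apply, Finsupp.single_apply, if_neg, if_neg, smul_zero, sub_zero]
    · intro e; rw [← e, Fin.val_rev] at hb; have := a.2; omega
    · intro e; rw [← e] at hb; omega
  · refine ⟨(a : Fin (n + 1)), by omega, ?_⟩
    rw [map_sub, map_smul, Finsupp.sub_apply, Finsupp.smul_apply, Basis.repr_self, Basis.repr_self, Finsupp.single_eq_same, Finsupp.single_apply, smul_eq_mul]
    by_cases e : Fin.rev (a : Fin (n + 1)) = (a : Fin (n + 1))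
    · have hod : Odd (((a : Fin (n + 1))) : ℕ) := by
        have h := congrArg Fin.val e; rw [Fin.val_rev] at h; have := a.2; exact Nat.odd_iff.mpr (by omega)
      rw [if_pos e, hod.neg_one_pow, mul_one, sub_neg_eq_add, ← two_mul, mul_one]; exact h2
    · rw [if_neg e, mul_zero, sub_zero]; exact one_ne_zero

/-- `n` even, `2 ≠ 0`: `2⌊n/4⌋ + 1 ≤ dim ker(Q − 1)`. -/
theorem le_finrank_ker_SbC_quarter_sub_one (h2 : (2 : K) ≠ 0) (he : Even n) : 2 * (n / 4) + 1 ≤ finrank K ↥(LinearMap.ker (SbC K 0 (-1) 1 0 (n := n) - 1)) := by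
  classical
  have hli := linearIndependent_spike_add_sign_rev K (n := n) h2
  let v : {a : Fin (n + 1) // 2 * (a : ℕ) < n ∨ (2 * (a : ℕ) = n ∧ (a : ℕ) % 2 = 0)} → ↥(LinearMap.ker (SbC K 0 (-1) 1 0 (n := n) - 1)) :=
    fun a => ⟨_, spike_add_sign_rev_mem_ker K he (a : Fin (n + 1))⟩
  have hv : LinearIndependent K v := LinearIndependent.of_comp (LinearMap.ker (SbC K 0 (-1) 1 0 (n := n) - 1)).subtype hli
  refine le_trans ?_ hv.fintype_card_le_finrank
  obtain ⟨k, hk⟩ := he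
  let ι : Fin (2 * (n / 4) + 1) → {a : Fin (n + 1) // 2 * (a : ℕ) < n ∨ (2 * (a : ℕ) = n ∧ (a : ℕ) % 2 = 0)} :=
    fun j => ⟨⟨j, by omega⟩, by show 2 * (j : ℕ) < n ∨ (2 * (j : ℕ) = n ∧ (j : ℕ) % 2 = 0); omega⟩
  have hι : Function.Injective ι := fun j j' e => Fin.ext (by simpa [ι] using congrArg (fun x => ((x.1 : Fin (n + 1)) : ℕ)) e)
  have h := Fintype.card_le_of_injective ι hι
  rwa [Fintype.card_fin] at h

/-- `n` even, `2 ≠ 0`: `2⌊(n+2)/4⌋ ≤ dim ker(Q + 1)`. -/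
theorem le_finrank_ker_SbC_quarter_add_one (h2 : (2 : K) ≠ 0) (he : Even n) : 2 * ((n + 2) / 4) ≤ finrank K ↥(LinearMap.ker (SbC K 0 (-1) 1 0 (n := n) + 1)) := by
  classical
  have hli := linearIndependent_spike_sub_sign_rev K (n := n) h2
  let v : {a : Fin (n + 1) // 2 * (a : ℕ) < n ∨ (2 * (a : ℕ) = n ∧ (a : ℕ) % 2 = 1)} → ↥(LinearMap.ker (SbC K 0 (-1) 1 0 (n := n) + 1)) :=
    fun a => ⟨_, spike_sub_sign_rev_mem_ker K he (a : Fin (n + 1))⟩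
  have hv : LinearIndependent K v := LinearIndependent.of_comp (LinearMap.ker (SbC K 0 (-1) 1 0 (n := n) + 1)).subtype hli
  refine le_trans ?_ hv.fintype_card_le_finrank
  obtain ⟨k, hk⟩ := he
  let ι : Fin (2 * ((n + 2) / 4)) → {a : Fin (n + 1) // 2 * (a : ℕ) < n ∨ (2 * (a : ℕ) = n ∧ (a : ℕ) % 2 = 1)} :=
    fun j => ⟨⟨j, by omega⟩, by show 2 * (j : ℕ) < n ∨ (2 * (j : ℕ) = n ∧ (j : ℕ) % 2 = 1); omega⟩
  have hι : Function.Injective ι := fun j j' e => Fin.ext (by simpa [ι] using congrArg (fun x => ((x.1 : Fin (n + 1)) : ℕ)) e)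
  have h := Fintype.card_le_of_injective ι hι
  rwa [Fintype.card_fin] at h

/-- **`n` EVEN, `2 ≠ 0`: `dim ker(SbC(0 −1 1 0) − 1) = 2⌊n/4⌋ + 1`** — `n/2 + 1` for `n ≡ 0 (4)`, `n/2` for `n ≡ 2 (4)` (no `√−1` needed). -/
theorem finrank_ker_SbC_quarter_sub_one (h2 : (2 : K) ≠ 0) (he : Even n) : finrank K ↥(LinearMap.ker (SbC K 0 (-1) 1 0 (n := n) - 1)) = 2 * (n / 4) + 1 := by
  have h1 := le_finrank_ker_SbC_quarter_sub_one K (n := n) h2 he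
  have h3 := le_finrank_ker_SbC_quarter_add_one K (n := n) h2 he
  have h4 := finrank_ker_sub_one_add_of_mul_self K h2 (SbC_quarter_mul_self_of_even K (n := n) he)
  rw [finrank_eq_card_basis (spikeBasis K n), Fintype.card_fin] at h4
  obtain ⟨k, hk⟩ := he
  omega

/-- **`n` EVEN, `2 ≠ 0`: `dim ker(SbC(0 −1 1 0) + 1) = 2⌊(n+2)/4⌋`** — `n/2` for `n ≡ 0 (4)`, `n/2 + 1` for `n ≡ 2 (4)`. -/
theorem finrank_ker_SbC_quarter_add_one (h2 : (2 : K) ≠ 0) (he : Even n) : finrank K ↥(LinearMap.ker (SbC K 0 (-1) 1 0 (n := n) + 1)) = 2 * ((n + 2) / 4) := by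
  have h1 := le_finrank_ker_SbC_quarter_sub_one K (n := n) h2 he
  have h3 := le_finrank_ker_SbC_quarter_add_one K (n := n) h2 he
  have h4 := finrank_ker_sub_one_add_of_mul_self K h2 (SbC_quarter_mul_self_of_even K (n := n) he)
  rw [finrank_eq_card_basis (spikeBasis K n), Fintype.card_fin] at h4
  obtain ⟨k, hk⟩ := he
  omega

/-- `n` even, `2 ≠ 0`: the class space is the direct sum of the two: `ker(Q − 1) ⊔ ker(Q + 1) = ⊤` (and `⊓ = ⊥`, §308). -/
theorem ker_SbC_quarter_sub_one_sup_add_one_eq_top (h2 : (2 : K) ≠ 0) (he : Even n) :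
    LinearMap.ker (SbC K 0 (-1) 1 0 (n := n) - 1) ⊔ LinearMap.ker (SbC K 0 (-1) 1 0 (n := n) + 1) = ⊤ :=
  ker_sub_one_sup_ker_add_one_eq_top_of_mul_self K h2 (SbC_quarter_mul_self_of_even K he)

/-- `n ≡ 0 (4)`: the two dimensions are `n/2 + 1` and `n/2` (the middle spike `E_{n/2}` is FIXED). -/
theorem finrank_ker_SbC_quarter_of_four_dvd (h2 : (2 : K) ≠ 0) (h4 : 4 ∣ n) :
    finrank K ↥(LinearMap.ker (SbC K 0 (-1) 1 0 (n := n) - 1)) = n / 2 + 1 ∧ finrank K ↥(LinearMap.ker (SbC K 0 (-1) 1 0 (n := n) + 1)) = n / 2 := by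
  obtain ⟨k, rfl⟩ := h4
  have he : Even (4 * k) := ⟨2 * k, by ring⟩
  rw [finrank_ker_SbC_quarter_sub_one K h2 he, finrank_ker_SbC_quarter_add_one K h2 he]
  omega

/-- `n ≡ 2 (4)`: the two dimensions are `n/2` and `n/2 + 1` (the middle spike `E_{n/2}` is NEGATED). -/
theorem finrank_ker_SbC_quarter_of_four_dvd_add_two (h2 : (2 : K) ≠ 0) {k : ℕ} (hk : n = 4 * k + 2) :
    finrank K ↥(LinearMap.ker (SbC K 0 (-1) 1 0 (n := n) - 1)) = n / 2 ∧ finrank K ↥(LinearMap.ker (SbC K 0 (-1) 1 0 (n := n) + 1)) = n / 2 + 1 := by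
  have he : Even n := ⟨2 * k + 1, by rw [hk]; ring⟩
  rw [finrank_ker_SbC_quarter_sub_one K h2 he, finrank_ker_SbC_quarter_add_one K h2 he]
  omega

end Summit.Ventures.HSemireg.Wedge.HankelFrameChange
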